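import Summits.Ventures.PercRepro.RankLevelSetCocircuitCount
import Summits.Ventures.PercRepro.RankLevelSetCorankFour
import Summits.Ventures.PercRepro.RankLevelSetCoreSparse
import Summits.Ventures.PercRepro.RankLevelSetDenseSplit
import Summits.Ventures.PercRepro.RankLevelSetTriangleStar

/-!
# PercRepro — the counts for C-025 at `q = 3` on the core of corank `5` (night-1, gen 2; part 1 of 2)

The `d = 5` cell of the `q = 3` row (`SmallCoreCells'`: the core at corank `5`, every `p ≥ 9`) was paper only. This
file collects the counts that RankLevelSetCorankFive turns into the inequality for every `p ≥ 31`: ON THE CORE of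
`rls_succ_all` (simple, rank `p`, every element with an `e`-free partition), CoreSparse's (C1) «lines have `≤ 3`
points» makes every set of rank `≤ 3` with `≥ 5` elements a subset of the small-circuit union
`S₀ = ⋃{circuits with ≤ 4 elements}` (Lemma 13.5, DenseSplit), a set of at most `20` elements and nullity `≤ 5`;
TriangleStar's `s₃ ≤ ν²` gives `s₃ ≤ 25` and the cocircuit count `s₄ ≤ 70` on it; hence
`#U ≤ C(n,3) + (25n + 70) + C(20,5)` and `#{r ≤ 3} ≤ Σ_{j≤3} C(n,j) + (25n + 70) + 2^20`.

* `sum_choose_succ_le_general` — Pascal: `Σ_{j<k} C(n+1,j) ≤ 2·Σ_{j<k} C(n,j)`;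
* `encard_le_eRk_add_of_encard_eq`, `exists_nullity_of_le` — nullity is monotone under restriction;
* `sUnion_circuitsLE_five_props`, `ncard_circuitsEq_three_le_corank_five_core`, `ncard_circuitsEq_four_le_corank_five`
  — `S₀` and `s₃ ≤ 25` (core), `s₄ ≤ 70` at corank `5`;
* `ncard_le_one_of_eRk_le_one`, `subset_sUnion_circuitsLE_of_eRk_le_three` — on the core, a set of rank `≤ 3` with
  `≥ 5` elements lies in `S₀`;
* `ncard_subsets_ncard_le_le`, `ncard_eRk_le_three_le_core`, `ncard_five_sets_eRk_le_three_core`,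
  **`topCount_le_corank_five`** — the counts.
Axioms: standard.
-/

namespace PercRepro

/-- **Pascal**: `Σ_{j<k} C(n+1, j) ≤ 2·Σ_{j<k} C(n, j)` for every `k`. -/
theorem sum_choose_succ_le_general (n k : ℕ) :
    (∑ j ∈ Finset.range k, (n + 1).choose j) ≤ 2 * ∑ j ∈ Finset.range k, n.choose j := by
  rcases k with _ | k
  · simp
  have h1 : (∑ j ∈ Finset.range (k + 1), (n + 1).choose j) =
      (∑ j ∈ Finset.range k, n.choose j) + ∑ j ∈ Finset.range (k + 1), n.choose j := by
    have hL : (∑ j ∈ Finset.range (k + 1), (n + 1).choose j) =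
        (∑ j ∈ Finset.range k, n.choose j) + ((∑ j ∈ Finset.range k, n.choose (j + 1)) + 1) := by
      rw [Finset.sum_range_succ' (fun j => (n + 1).choose j), Nat.choose_zero_right]
      have hc : ∑ j ∈ Finset.range k, (n + 1).choose (j + 1) =
          ∑ j ∈ Finset.range k, (n.choose j + n.choose (j + 1)) :=
        Finset.sum_congr rfl (fun j _ => Nat.choose_succ_succ n j)
      rw [hc, Finset.sum_add_distrib]
      ring
    have hR : (∑ j ∈ Finset.range (k + 1), n.choose j) =
        (∑ j ∈ Finset.range k, n.choose (j + 1)) + 1 := by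
      rw [Finset.sum_range_succ' (fun j => n.choose j), Nat.choose_zero_right]
    rw [hL, hR]
  have h2 : (∑ j ∈ Finset.range k, n.choose j) ≤ ∑ j ∈ Finset.range (k + 1), n.choose j :=
    Finset.sum_le_sum_of_subset_of_nonneg (Finset.range_mono (by omega))
      (fun _ _ _ => Nat.zero_le _)
  omega

namespace Matroid

open Set

section universePolymorphic

variable {α : Type*} {M : _root_.Matroid α}

/-- **Nullity is monotone**: if `|E| = r(E) + d` then every `S ⊆ E` has `|S| ≤ r(S) + d`
(`r(E) ≤ r(S) + |E ∖ S|` by submodularity). -/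
theorem encard_le_eRk_add_of_encard_eq [M.Finite] {S : Set α} (hS : S ⊆ M.E) {d : ℕ}
    (hd : M.E.encard = M.eRank + d) : S.encard ≤ M.eRk S + d := by
  have h1 : M.eRank ≤ M.eRk S + (M.E \ S).encard := by
    rw [← M.eRk_ground]
    calc M.eRk M.E = M.eRk (S ∪ (M.E \ S)) := by rw [union_sdiff_cancel hS]
      _ ≤ M.eRk S + M.eRk (M.E \ S) := M.eRk_union_le_eRk_add_eRk S (M.E \ S)
      _ ≤ M.eRk S + (M.E \ S).encard := by gcongr; exact M.eRk_le_encard _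
  have h2 : S.encard + (M.E \ S).encard = M.E.encard := by
    rw [add_comm]; exact Set.encard_sdiff_add_encard_of_subset hS
  have hfin : (M.E \ S).encard ≠ ⊤ := (M.ground_finite.subset sdiff_subset).encard_lt_top.ne
  have h3 : S.encard + (M.E \ S).encard ≤ (M.eRk S + d) + (M.E \ S).encard := by
    rw [h2, hd]
    calc M.eRank + d ≤ (M.eRk S + (M.E \ S).encard) + d := by gcongr
      _ = (M.eRk S + d) + (M.E \ S).encard := by ring
  exact (WithTop.add_le_add_iff_right hfin).1 h3

/-- A finite set `S` with `|S| ≤ r(S) + d` has an exact nullity `d' ≤ d`: `|S| = r(S) + d'`. -/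
theorem exists_nullity_of_le {S : Set α} (hfin : S.Finite) {d : ℕ} (h : S.encard ≤ M.eRk S + d) :
    ∃ d' ≤ d, S.encard = M.eRk S + d' := by
  have hr : M.eRk S ≠ ⊤ := ne_top_of_le_ne_top hfin.encard_lt_top.ne (M.eRk_le_encard S)
  obtain ⟨r, hr'⟩ := ENat.ne_top_iff_exists.1 hr
  rw [← hfin.cast_ncard_eq, ← hr'] at h ⊢
  have hle : r ≤ S.ncard := by
    have := M.eRk_le_encard S
    rw [← hfin.cast_ncard_eq, ← hr'] at this
    exact_mod_cast this
  have h' : S.ncard ≤ r + d := by exact_mod_cast h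
  refine ⟨S.ncard - r, by omega, ?_⟩
  rw [← Nat.cast_add]
  congr 1
  omega

end universePolymorphic

variable {α : Type} {M : _root_.Matroid α}

/-- The small-circuit union `S₀` at corank `5`: `S₀ ⊆ E`, `|S₀| ≤ 20`, `|S₀| ≤ r(S₀) + 5`, and every circuit with
`≤ 4` elements lies in it. -/
theorem sUnion_circuitsLE_five_props [M.Finite] (hd : M.E.encard = M.eRank + 5) :
    ⋃₀ circuitsLE M 4 ⊆ M.E ∧ (⋃₀ circuitsLE M 4).ncard ≤ 20 ∧
      (⋃₀ circuitsLE M 4).encard ≤ M.eRk (⋃₀ circuitsLE M 4) + 5 ∧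
      (∀ C, M.IsCircuit C → C.ncard ≤ 4 → C ⊆ ⋃₀ circuitsLE M 4) := by
  have hSE : ⋃₀ circuitsLE M 4 ⊆ M.E := by
    intro x hx
    obtain ⟨C, hC, hxC⟩ := Set.mem_sUnion.1 hx
    exact subset_ground_of_mem_circuitsLE hC hxC
  have hSfin : (⋃₀ circuitsLE M 4).Finite := M.ground_finite.subset hSE
  refine ⟨hSE, ?_, encard_le_eRk_add_of_encard_eq hSE hd, ?_⟩
  · have h := encard_sUnion_circuitsLE_le (M := M) (k := 4) (d := 5) hd
    rw [← hSfin.cast_ncard_eq] at h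
    exact_mod_cast h
  · intro C hC hC4
    refine subset_sUnion_of_mem ⟨hC, ?_⟩
    have hfin : C.Finite := M.ground_finite.subset hC.subset_ground
    rw [← hfin.cast_ncard_eq]
    exact_mod_cast hC4

/-- **`s₃ ≤ 25` on the core at corank `5`** (TriangleStar's `s₃(S₀) ≤ ν(S₀)²` with `ν(S₀) ≤ 5`). -/
theorem ncard_circuitsEq_three_le_corank_five_core [M.Finite]
    (hs : ∀ e ∈ M.E, ∀ f ∈ M.E, e ≠ f → M.eRk {e, f} = 2)
    (hfree : ∀ e ∈ M.E, ∃ A ⊆ M.E \ {e}, e ∉ M.closure A ∧ e ∉ M.closure ((M.E \ {e}) \ A))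
    (hd : M.E.encard = M.eRank + 5) : (circuitsEq M 3).ncard ≤ 25 := by
  obtain ⟨hSE, hS20, hν, hcov⟩ := sUnion_circuitsLE_five_props hd
  obtain ⟨d', hd'5, hd'⟩ := exists_nullity_of_le (M.ground_finite.subset hSE) hν
  have h := ThmN.core_ncard_triangles_subset_le_sq M hs hfree hSE hd'
  have heq : circuitsEq M 3 = {C : Set α | M.IsCircuit C ∧ C.ncard = 3 ∧ C ⊆ ⋃₀ circuitsLE M 4} := by
    ext C
    exact ⟨fun hC => ⟨hC.1, hC.2, hcov C hC.1 (by rw [hC.2]; norm_num)⟩, fun hC => ⟨hC.1, hC.2.1⟩⟩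
  rw [heq]
  exact h.trans (by nlinarith)

/-- **`s₄ ≤ 70` at corank `5`.** -/
theorem ncard_circuitsEq_four_le_corank_five [M.Finite] (hd : M.E.encard = M.eRank + 5) :
    (circuitsEq M 4).ncard ≤ 70 := by
  obtain ⟨hSE, hS20, hν, hcov⟩ := sUnion_circuitsLE_five_props hd
  exact ncard_isCircuit_four_le_of_subset_nullity_le_five M hSE
    (fun C hC h4 => hcov C hC (by omega)) hS20 hν

/-- In a simple matroid (pairs have rank `2`) a set of rank `≤ 1` has at most one element. -/
theorem ncard_le_one_of_eRk_le_one [M.Finite]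
    (hs : ∀ e ∈ M.E, ∀ f ∈ M.E, e ≠ f → M.eRk {e, f} = 2) {X : Set α} (hX : X ⊆ M.E)
    (hr : M.eRk X ≤ 1) : X.ncard ≤ 1 := by
  rw [Set.ncard_le_one_iff (M.ground_finite.subset hX)]
  intro a b ha hb
  by_contra hab
  have h2 : M.eRk {a, b} = 2 := hs a (hX ha) b (hX hb) hab
  have hsub : ({a, b} : Set α) ⊆ X := by
    intro x hx
    rcases hx with rfl | rfl
    · exact ha
    · exact hb
  have := (M.eRk_mono hsub).trans hr
  rw [h2] at this
  exact absurd this (by norm_num)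

/-- **On the core, a set of rank `≤ 3` with `≥ 5` elements lies in `S₀`** (Lemma 13.5 + (C1)): `r(S) = r(S ∩ S₀) +
|S ∖ S₀|`, and a point outside `S₀` would leave `S ∩ S₀` with `≥ 4` points of rank `≤ 2`. -/
theorem subset_sUnion_circuitsLE_of_eRk_le_three [M.Finite]
    (hs : ∀ e ∈ M.E, ∀ f ∈ M.E, e ≠ f → M.eRk {e, f} = 2)
    (hfree : ∀ e ∈ M.E, ∃ A ⊆ M.E \ {e}, e ∉ M.closure A ∧ e ∉ M.closure ((M.E \ {e}) \ A))
    {S : Set α} (hS : S ⊆ M.E) (hr : M.eRk S ≤ 3) (h5 : 5 ≤ S.ncard) :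
    S ⊆ ⋃₀ circuitsLE M 4 := by
  have hSfin : S.Finite := M.ground_finite.subset hS
  have hsplit := eRk_eq_eRk_inter_add_encard_sdiff hS hr
  have hIfin : (S ∩ ⋃₀ circuitsLE M 4).Finite := hSfin.subset inter_subset_left
  have hDfin : (S \ ⋃₀ circuitsLE M 4).Finite := hSfin.sdiff
  have hcard : (S ∩ ⋃₀ circuitsLE M 4).ncard + (S \ ⋃₀ circuitsLE M 4).ncard = S.ncard := by
    rw [Set.ncard_inter_add_ncard_sdiff_eq_ncard S (⋃₀ circuitsLE M 4) hSfin]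
  -- the rank of the inner part, in natural numbers
  have hIsub : S ∩ ⋃₀ circuitsLE M 4 ⊆ M.E := inter_subset_left.trans hS
  by_contra hnot
  have hDpos : 1 ≤ (S \ ⋃₀ circuitsLE M 4).ncard := by
    rw [Nat.one_le_iff_ne_zero, Ne, Set.ncard_eq_zero hDfin, Set.sdiff_eq_empty]
    exact hnot
  -- `r(S ∩ S₀) + |S ∖ S₀| ≤ 3`
  have hkey : M.eRk (S ∩ ⋃₀ circuitsLE M 4) + ((S \ ⋃₀ circuitsLE M 4).ncard : ℕ∞) ≤ 3 := by
    rw [hDfin.cast_ncard_eq, ← hsplit]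
    exact hr
  -- `|S ∖ S₀| ≤ 3` (rank)
  have hD3 : (S \ ⋃₀ circuitsLE M 4).ncard ≤ 3 := by
    have := (le_add_self).trans hkey
    exact_mod_cast this
  -- hence `r(S ∩ S₀) ≤ 2` and `|S ∩ S₀| ≥ 4`, or `r(S ∩ S₀) ≤ 1` and `|S ∩ S₀| ≥ 3`, …: all impossible
  have hIcard : 4 ≤ (S ∩ ⋃₀ circuitsLE M 4).ncard ∨
      (2 ≤ (S \ ⋃₀ circuitsLE M 4).ncard ∧ 3 ≤ (S ∩ ⋃₀ circuitsLE M 4).ncard) ∨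
      (3 ≤ (S \ ⋃₀ circuitsLE M 4).ncard ∧ 2 ≤ (S ∩ ⋃₀ circuitsLE M 4).ncard) := by omega
  -- the inner rank is `≤ 3 − |S ∖ S₀|`
  have hrI : M.eRk (S ∩ ⋃₀ circuitsLE M 4) ≤ ((3 - (S \ ⋃₀ circuitsLE M 4).ncard : ℕ) : ℕ∞) := by
    have : ((3 : ℕ) : ℕ∞) = ((3 - (S \ ⋃₀ circuitsLE M 4).ncard : ℕ) : ℕ∞) +
        ((S \ ⋃₀ circuitsLE M 4).ncard : ℕ∞) := by
      rw [← Nat.cast_add, Nat.sub_add_cancel hD3]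
    have h3 : M.eRk (S ∩ ⋃₀ circuitsLE M 4) + ((S \ ⋃₀ circuitsLE M 4).ncard : ℕ∞) ≤
        ((3 - (S \ ⋃₀ circuitsLE M 4).ncard : ℕ) : ℕ∞) + ((S \ ⋃₀ circuitsLE M 4).ncard : ℕ∞) := by
      rw [← this]; exact_mod_cast hkey
    exact (WithTop.add_le_add_iff_right (ENat.coe_ne_top _)).1 h3
  rcases hIcard with h4 | ⟨hD2, hI3⟩ | ⟨hD3, hI2⟩
  · -- `|S ∖ S₀| ≥ 1`: the inner part has rank `≤ 2` and `≥ 4` points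
    have hr2 : M.eRk (S ∩ ⋃₀ circuitsLE M 4) ≤ 2 :=
      hrI.trans (by exact_mod_cast (by omega : 3 - (S \ ⋃₀ circuitsLE M 4).ncard ≤ 2))
    rcases (show M.eRk (S ∩ ⋃₀ circuitsLE M 4) ≤ 1 ∨ M.eRk (S ∩ ⋃₀ circuitsLE M 4) = 2 by
        rcases hr2.lt_or_eq with h | h
        · left
          have h' : (2 : ℕ∞) = 1 + 1 := by norm_num
          rw [h', ENat.lt_add_one_iff (by simp)] at h
          exact h
        · right; exact h) with h1 | h2
    · have := ncard_le_one_of_eRk_le_one hs hIsub h1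
      omega
    · have := ThmN.ncard_le_three_of_eRk_two M hs hfree hIsub h2
      omega
  · -- `|S ∖ S₀| ≥ 2`: the inner part has rank `≤ 1` and `≥ 3` points
    have hr1 : M.eRk (S ∩ ⋃₀ circuitsLE M 4) ≤ 1 :=
      hrI.trans (by exact_mod_cast (by omega : 3 - (S \ ⋃₀ circuitsLE M 4).ncard ≤ 1))
    have := ncard_le_one_of_eRk_le_one hs hIsub hr1
    omega
  · -- `|S ∖ S₀| ≥ 3`: the inner part has rank `0` and `≥ 2` points
    have hr0 : M.eRk (S ∩ ⋃₀ circuitsLE M 4) ≤ 1 :=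
      hrI.trans (by exact_mod_cast (by omega : 3 - (S \ ⋃₀ circuitsLE M 4).ncard ≤ 1))
    have := ncard_le_one_of_eRk_le_one hs hIsub hr0
    omega

/-- `#{X ⊆ E : |X| ≤ k} ≤ Σ_{j ≤ k} C(|E|, j)`. -/
theorem ncard_subsets_ncard_le_le [M.Finite] (k : ℕ) :
    {X : Set α | X ⊆ M.E ∧ X.ncard ≤ k}.ncard ≤ ∑ j ∈ Finset.range (k + 1), M.E.ncard.choose j := by
  induction k with
  | zero =>
    rw [Finset.sum_range_one, ← Set.ncard_powerset_ncard M.ground_finite 0]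
    exact Set.ncard_le_ncard (fun X hX => ⟨hX.1, by have := hX.2; omega⟩)
      (M.ground_finite.finite_subsets.subset (fun X hX => hX.1))
  | succ k ih =>
    rw [Finset.sum_range_succ, ← Set.ncard_powerset_ncard M.ground_finite (k + 1)]
    have hsub : {X : Set α | X ⊆ M.E ∧ X.ncard ≤ k + 1} ⊆
        {X : Set α | X ⊆ M.E ∧ X.ncard ≤ k} ∪ {X | X ⊆ M.E ∧ X.ncard = k + 1} := by
      intro X hX
      obtain ⟨hXE, hXk⟩ := hX
      rcases Nat.lt_or_ge X.ncard (k + 1) with h | h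
      · exact Or.inl ⟨hXE, by omega⟩
      · exact Or.inr ⟨hXE, by omega⟩
    have hfin : ({X : Set α | X ⊆ M.E ∧ X.ncard ≤ k} ∪ {X | X ⊆ M.E ∧ X.ncard = k + 1}).Finite :=
      (M.ground_finite.finite_subsets.subset (fun X hX => hX.1)).union
        (M.ground_finite.finite_subsets.subset (fun X hX => hX.1))
    calc {X : Set α | X ⊆ M.E ∧ X.ncard ≤ k + 1}.ncard
        ≤ ({X : Set α | X ⊆ M.E ∧ X.ncard ≤ k} ∪ {X | X ⊆ M.E ∧ X.ncard = k + 1}).ncard :=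
          Set.ncard_le_ncard hsub hfin
      _ ≤ {X : Set α | X ⊆ M.E ∧ X.ncard ≤ k}.ncard + {X | X ⊆ M.E ∧ X.ncard = k + 1}.ncard :=
          Set.ncard_union_le _ _
      _ ≤ _ := by gcongr

/-- **The sets of rank `≤ 3` on the core at corank `5`**: at most `Σ_{j≤3} C(n,j) + (s₃·n + s₄) + 2^20`
(the small ones, the `4`-sets, and the subsets of `S₀`). -/
theorem ncard_eRk_le_three_le_core [M.Finite]
    (hs : ∀ e ∈ M.E, ∀ f ∈ M.E, e ≠ f → M.eRk {e, f} = 2)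
    (hfree : ∀ e ∈ M.E, ∃ A ⊆ M.E \ {e}, e ∉ M.closure A ∧ e ∉ M.closure ((M.E \ {e}) \ A))
    (hcirc : ∀ C, M.IsCircuit C → 3 ≤ C.encard) (hd : M.E.encard = M.eRank + 5) :
    {X : Set α | X ⊆ M.E ∧ M.eRk X ≤ ((3 : ℕ) : ℕ∞)}.ncard ≤
      (∑ j ∈ Finset.range 4, M.E.ncard.choose j) +
      ((circuitsEq M 3).ncard * M.E.ncard + (circuitsEq M 4).ncard) + 2 ^ 20 := by
  classical
  obtain ⟨hSE, hS20, -, -⟩ := sUnion_circuitsLE_five_props hd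
  have hSfin : (⋃₀ circuitsLE M 4).Finite := M.ground_finite.subset hSE
  have hsub : {X : Set α | X ⊆ M.E ∧ M.eRk X ≤ ((3 : ℕ) : ℕ∞)} ⊆
      ({X : Set α | X ⊆ M.E ∧ X.ncard ≤ 3} ∪ {B : Set α | B ⊆ M.E ∧ B.ncard = 4 ∧ M.eRk B ≤ 3}) ∪
        𝒫 (⋃₀ circuitsLE M 4) := by
    intro X hX
    obtain ⟨hXE, hXr⟩ := hX
    have hXr' : M.eRk X ≤ 3 := by exact_mod_cast hXr
    rcases Nat.lt_or_ge X.ncard 4 with h | h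
    · exact Or.inl (Or.inl ⟨hXE, by omega⟩)
    rcases Nat.lt_or_ge X.ncard 5 with h' | h'
    · exact Or.inl (Or.inr ⟨hXE, by omega, hXr'⟩)
    · exact Or.inr (subset_sUnion_circuitsLE_of_eRk_le_three hs hfree hXE hXr' h')
  have hfin1 : ({X : Set α | X ⊆ M.E ∧ X.ncard ≤ 3} ∪
      {B : Set α | B ⊆ M.E ∧ B.ncard = 4 ∧ M.eRk B ≤ 3}).Finite :=
    (M.ground_finite.finite_subsets.subset (fun X hX => hX.1)).union
      (M.ground_finite.finite_subsets.subset (fun X hX => hX.1))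
  have hfin2 : (𝒫 (⋃₀ circuitsLE M 4)).Finite := hSfin.finite_subsets
  have hE : M.ground_finite.toFinset.card = M.E.ncard :=
    (Set.ncard_eq_toFinset_card _ M.ground_finite).symm
  calc {X : Set α | X ⊆ M.E ∧ M.eRk X ≤ ((3 : ℕ) : ℕ∞)}.ncard
      ≤ (({X : Set α | X ⊆ M.E ∧ X.ncard ≤ 3} ∪ {B : Set α | B ⊆ M.E ∧ B.ncard = 4 ∧ M.eRk B ≤ 3}) ∪
          𝒫 (⋃₀ circuitsLE M 4)).ncard := Set.ncard_le_ncard hsub (hfin1.union hfin2)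
    _ ≤ ({X : Set α | X ⊆ M.E ∧ X.ncard ≤ 3} ∪ {B : Set α | B ⊆ M.E ∧ B.ncard = 4 ∧ M.eRk B ≤ 3}).ncard +
          (𝒫 (⋃₀ circuitsLE M 4)).ncard := Set.ncard_union_le _ _
    _ ≤ ({X : Set α | X ⊆ M.E ∧ X.ncard ≤ 3}.ncard +
          {B : Set α | B ⊆ M.E ∧ B.ncard = 4 ∧ M.eRk B ≤ 3}.ncard) + (𝒫 (⋃₀ circuitsLE M 4)).ncard := by
        gcongr
        exact Set.ncard_union_le _ _
    _ ≤ (∑ j ∈ Finset.range 4, M.E.ncard.choose j) +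
          ((circuitsEq M 3).ncard * M.E.ncard + (circuitsEq M 4).ncard) + 2 ^ 20 := by
        have h1 := ncard_subsets_ncard_le_le (M := M) 3
        rw [show (3 + 1 : ℕ) = 4 from rfl] at h1
        have h2 := ncard_four_sets_eRk_le_three (M := M) hcirc
        rw [hE] at h2
        have h3 : (𝒫 (⋃₀ circuitsLE M 4)).ncard ≤ 2 ^ 20 := by
          rw [Set.ncard_powerset _ hSfin]
          exact Nat.pow_le_pow_right (by norm_num) hS20
        omega

/-- **The `5`-sets of rank `≤ 3` on the core at corank `5`**: at most `C(20, 5)` (they lie in `S₀`). -/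
theorem ncard_five_sets_eRk_le_three_core [M.Finite]
    (hs : ∀ e ∈ M.E, ∀ f ∈ M.E, e ≠ f → M.eRk {e, f} = 2)
    (hfree : ∀ e ∈ M.E, ∃ A ⊆ M.E \ {e}, e ∉ M.closure A ∧ e ∉ M.closure ((M.E \ {e}) \ A))
    (hd : M.E.encard = M.eRank + 5) :
    {B : Set α | B ⊆ M.E ∧ B.ncard = 5 ∧ M.eRk B ≤ 3}.ncard ≤ Nat.choose 20 5 := by
  obtain ⟨hSE, hS20, -, -⟩ := sUnion_circuitsLE_five_props hd
  have hSfin : (⋃₀ circuitsLE M 4).Finite := M.ground_finite.subset hSE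
  calc {B : Set α | B ⊆ M.E ∧ B.ncard = 5 ∧ M.eRk B ≤ 3}.ncard
      ≤ {B : Set α | B ⊆ ⋃₀ circuitsLE M 4 ∧ B.ncard = 5}.ncard := by
        refine Set.ncard_le_ncard (fun B hB => ?_) (hSfin.finite_subsets.subset (fun B hB => hB.1))
        obtain ⟨hBE, hB5, hBr⟩ := hB
        exact ⟨subset_sUnion_circuitsLE_of_eRk_le_three hs hfree hBE hBr (by omega), hB5⟩
    _ = (⋃₀ circuitsLE M 4).ncard.choose 5 := Set.ncard_powerset_ncard hSfin 5
    _ ≤ Nat.choose 20 5 := Nat.choose_le_choose 5 hS20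

/-- **`#U(p,3)` at corank `5`**: the rank-`3` side `B = E ∖ A` of a `U`-partition is coindependent, so it has `3`,
`4` or `5` elements: `#U ≤ C(n,3) + #{4-sets of rank ≤ 3} + #{5-sets of rank ≤ 3}`. -/
theorem topCount_le_corank_five [M.Finite] {p : ℕ}
    (hd : M.E.encard = M.eRank + 5) (hR : M.eRank = (p : ℕ∞)) :
    topCount M p 3 ≤ M.E.ncard.choose 3 + {B : Set α | B ⊆ M.E ∧ B.ncard = 4 ∧ M.eRk B ≤ 3}.ncard +
      {B : Set α | B ⊆ M.E ∧ B.ncard = 5 ∧ M.eRk B ≤ 3}.ncard := by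
  classical
  have hinj : Set.InjOn (fun A : Set α => M.E \ A)
      {A : Set α | A ⊆ M.E ∧ M.eRk A = (p : ℕ∞) ∧ M.eRk (M.E \ A) = ((3 : ℕ) : ℕ∞)} := by
    intro X hX Y hY hXY
    simp only at hXY
    rw [← Set.sdiff_sdiff_cancel_left hX.1, hXY, Set.sdiff_sdiff_cancel_left hY.1]
  have hmaps : ∀ A ∈ {A : Set α | A ⊆ M.E ∧ M.eRk A = (p : ℕ∞) ∧ M.eRk (M.E \ A) = ((3 : ℕ) : ℕ∞)},
      (fun A : Set α => M.E \ A) A ∈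
        ({B : Set α | B ⊆ M.E ∧ B.ncard = 3} ∪ {B : Set α | B ⊆ M.E ∧ B.ncard = 4 ∧ M.eRk B ≤ 3}) ∪
        {B : Set α | B ⊆ M.E ∧ B.ncard = 5 ∧ M.eRk B ≤ 3} := by
    rintro A ⟨hAE, hAr, hBr⟩
    simp only
    have hBE : M.E \ A ⊆ M.E := Set.sdiff_subset
    have hBfin : (M.E \ A).Finite := M.ground_finite.subset hBE
    have h3 : ((3 : ℕ) : ℕ∞) ≤ (M.E \ A).encard := by rw [← hBr]; exact M.eRk_le_encard _
    have hAp : (p : ℕ∞) ≤ A.encard := by rw [← hAr]; exact M.eRk_le_encard A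
    have hsum : A.encard + (M.E \ A).encard = M.E.encard := by
      rw [add_comm]; exact Set.encard_sdiff_add_encard_of_subset hAE
    have h5 : (M.E \ A).encard ≤ 5 := by
      have h : (p : ℕ∞) + (M.E \ A).encard ≤ (p : ℕ∞) + 5 := by
        calc (p : ℕ∞) + (M.E \ A).encard ≤ A.encard + (M.E \ A).encard := by gcongr
          _ = M.E.encard := hsum
          _ = (p : ℕ∞) + 5 := by rw [hd, hR]
      exact (WithTop.add_le_add_iff_left (WithTop.natCast_ne_top p)).1 h
    rw [← hBfin.cast_ncard_eq] at h3 h5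
    have h3' : 3 ≤ (M.E \ A).ncard := by exact_mod_cast h3
    have h5' : (M.E \ A).ncard ≤ 5 := by exact_mod_cast h5
    have hBr' : M.eRk (M.E \ A) ≤ 3 := by rw [hBr]; exact_mod_cast le_refl (3 : ℕ)
    rcases Nat.lt_or_ge (M.E \ A).ncard 4 with hlt | hge
    · exact Or.inl (Or.inl ⟨hBE, by omega⟩)
    rcases Nat.lt_or_ge (M.E \ A).ncard 5 with hlt' | hge'
    · exact Or.inl (Or.inr ⟨hBE, by omega, hBr'⟩)
    · exact Or.inr ⟨hBE, by omega, hBr'⟩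
  have hfin : (({B : Set α | B ⊆ M.E ∧ B.ncard = 3} ∪ {B : Set α | B ⊆ M.E ∧ B.ncard = 4 ∧ M.eRk B ≤ 3}) ∪
        {B : Set α | B ⊆ M.E ∧ B.ncard = 5 ∧ M.eRk B ≤ 3}).Finite :=
    ((M.ground_finite.finite_subsets.subset (fun X hX => hX.1)).union
      (M.ground_finite.finite_subsets.subset (fun X hX => hX.1))).union
      (M.ground_finite.finite_subsets.subset (fun X hX => hX.1))
  calc topCount M p 3
      = {A : Set α | A ⊆ M.E ∧ M.eRk A = (p : ℕ∞) ∧ M.eRk (M.E \ A) = ((3 : ℕ) : ℕ∞)}.ncard := rfl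
    _ ≤ (({B : Set α | B ⊆ M.E ∧ B.ncard = 3} ∪ {B : Set α | B ⊆ M.E ∧ B.ncard = 4 ∧ M.eRk B ≤ 3}) ∪
          {B : Set α | B ⊆ M.E ∧ B.ncard = 5 ∧ M.eRk B ≤ 3}).ncard :=
        Set.ncard_le_ncard_of_injOn _ hmaps hinj hfin
    _ ≤ ({B : Set α | B ⊆ M.E ∧ B.ncard = 3} ∪ {B : Set α | B ⊆ M.E ∧ B.ncard = 4 ∧ M.eRk B ≤ 3}).ncard +
          {B : Set α | B ⊆ M.E ∧ B.ncard = 5 ∧ M.eRk B ≤ 3}.ncard := Set.ncard_union_le _ _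
    _ ≤ ({B : Set α | B ⊆ M.E ∧ B.ncard = 3}.ncard +
          {B : Set α | B ⊆ M.E ∧ B.ncard = 4 ∧ M.eRk B ≤ 3}.ncard) +
          {B : Set α | B ⊆ M.E ∧ B.ncard = 5 ∧ M.eRk B ≤ 3}.ncard := by
        gcongr
        exact Set.ncard_union_le _ _
    _ = _ := by rw [Set.ncard_powerset_ncard M.ground_finite 3]

end Matroid


end PercRepro
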